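import Literature.NumberTheory.Automorphic.SatakeTransformGLIwasawaDatum
import Literature.NumberTheory.Automorphic.SymplecticGroupCartanUnique
import HarnessLib

/-!
# Bridge between the `Valued K ℤᵐ⁰` setting (unitary / symplectic files) and the `ValuativeRel` setting (the `GL_n` Satake
# files): integers, discrete valuation ring, uniformizers, residue field, `GL_n(𝒪)`, Iwasawa exponents

Topic `NumberTheory/Automorphic`; namespace `Literature.NumberTheory.Automorphic` (lane `lit-hodgefound`, Track 2 foundations;
seat `lit-hodgefound-p11`, generation 48, row g48-#1).  THEOREMS ONLY: no definition, no named fact, no instance, no notation.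

## Why

The tree's theory of the spherical Hecke algebra of `GL_n` (`SatakeTransformGL`, `SatakeIsomorphismModP`,
`SatakeIsomorphismGLNormalisations`, …: Cartan/Iwasawa decompositions, the Satake isomorphism onto the `S_n`-invariants in every
normalisation) is written for a field `F` carrying Mathlib's `ValuativeRel F` with `𝒪[F]` a discrete valuation ring, finite
residue field and a uniformizing element `ϖ` (`IsUniformizingElement ϖ`).  The theory of the quasi-split unitary groups
`U(σ, J₀)` and of `Sp_{2n}`, `GSp_{2n}` (`HyperspecialUnitary*`, `Symplectic*`) is written for a field `K` carrying Mathlib's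
`Valued K ℤᵐ⁰` with a uniformizer `v ϖ = exp (-1)`.  To run the `GL_n` theory on the LEVI SUBGROUPS of `U(σ, J₀)` (the Siegel
Levi `GL_n(K)`, Cartier §IV proof of Thm. 4.1 (b): the Satake transform is transitive along parabolic subgroups) one needs the
two settings on the SAME field: Mathlib provides `ValuativeRel.ofValuation Valued.v` with `Valued.v.Compatible`
(`Valuation.Compatible.ofValuation`; the tree registers exactly these instances on adic completions of number fields,
`AdicCompletionLocalField`).  This file proves, for any field with BOTH structures and `Valued.v` compatible with the valuative
relation, that the two worlds agree:

* §1 `v_le_iff_valuation_le`, `v_le_one_iff_valuation_le_one`, `v_lt_one_iff_valuation_lt_one`, `v_eq_one_iff_valuation_eq_one`,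
  `v_le_one_iff_mem_integer` (`Valued.v x ≤ 1 ↔ x ∈ 𝒪[K]`, the `ValuativeRel` valuation ring), **`valuedInteger_eq_integer`**
  (`Valued.integer K = 𝒪[K]` as subrings).
* §2 **`isDiscreteValuationRing_integer_of_compatible`** (`𝒪[K]` is a DVR as soon as `K` has a uniformizer, transported from
  the tree's `CartanUnique.isDiscreteValuationRing_integer` along `RingEquiv.subringCongr`), **`isUniformizingElement_of_v_eq`**
  (`v ϖ = exp (-1)` ⇒ `IsUniformizingElement ϖ`), `finite_residueField_of_compatible`, **`natCard_residueField_eq_of_compatible`**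
  (the two residue fields have the same cardinality `q`).
* §3 **`mem_glInt_iff_forall_v_le_one`** (`g ∈ GL_n(𝒪)` iff all entries of `g` and `g⁻¹` have `Valued.v ≤ 1`).
* §4 **`v_apply_self_eq_exp_neg_iwasawaExp_gl`** — for an upper triangular `b ∈ GL_n(K)` the tree's Iwasawa exponents
  `iwasawaExp hϖ b` (`SatakeTransformGL`) are read off the diagonal: `Valued.v (b i i) = exp (-(iwasawaExp hϖ b) i)`; and
  `iwasawaExp_eq_of_forall_v_apply_self_eq` (any exponent vector with this property IS `iwasawaExp`).

## The print

[Serre1979] Ch. I §1 (discrete valuation rings, `x = π^n u`), Ch. II §1; [CartierCorvallis1979] §IV.1–4.2 (`K = GL_n(𝒪)`,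
`G = U A K` and the exponent `H(m)`); [BruhatTits1972] (4.4.3).  No new mathematics: this is the dictionary between two
formalisations of the same non-archimedean valuation.

## References
* [Serre1979] J.-P. Serre, *Local Fields*, GTM 67 (1979), Ch. I §1, Prop. 1.
* [CartierCorvallis1979] P. Cartier, *Representations of 𝔭-adic groups: a survey*, PSPM 33.1 (1979), §IV.1, (4.2).
* [BruhatTits1972] F. Bruhat, J. Tits, *Groupes réductifs sur un corps local I*, Publ. Math. IHÉS 41 (1972), (4.4.3).
-/

noncomputable section

open scoped WithZero MatrixGroups
open ValuativeRel Matrix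

namespace Literature.NumberTheory.Automorphic

variable {K : Type*} [Field K] [Valued K ℤᵐ⁰] [ValuativeRel K] [(Valued.v : Valuation K ℤᵐ⁰).Compatible]

/-! ## §1 The two valuations define the same order, the same integers -/

/-- `Valued.v x ≤ Valued.v y ↔ valuation K x ≤ valuation K y` (both are compatible with `≤ᵥ`). [cite: Serre1979, Ch. II §1] -/
theorem v_le_iff_valuation_le (x y : K) : Valued.v x ≤ Valued.v y ↔ valuation K x ≤ valuation K y := by
  rw [← Valuation.vle_iff_le (Valued.v : Valuation K ℤᵐ⁰), Valuation.vle_iff_le (valuation K)]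

/-- `Valued.v x < Valued.v y ↔ valuation K x < valuation K y`. [cite: Serre1979, Ch. II §1] -/
theorem v_lt_iff_valuation_lt (x y : K) : Valued.v x < Valued.v y ↔ valuation K x < valuation K y := by
  rw [← Valuation.vlt_iff_lt (Valued.v : Valuation K ℤᵐ⁰), Valuation.vlt_iff_lt (valuation K)]

/-- `Valued.v x = Valued.v y ↔ valuation K x = valuation K y`. [cite: Serre1979, Ch. II §1] -/
theorem v_eq_iff_valuation_eq (x y : K) : Valued.v x = Valued.v y ↔ valuation K x = valuation K y := by
  rw [le_antisymm_iff, le_antisymm_iff, v_le_iff_valuation_le, v_le_iff_valuation_le]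

/-- `Valued.v x ≤ 1 ↔ valuation K x ≤ 1`. [cite: Serre1979, Ch. II §1] -/
theorem v_le_one_iff_valuation_le_one (x : K) : Valued.v x ≤ 1 ↔ valuation K x ≤ 1 := by
  rw [← Valuation.vle_one_iff (Valued.v : Valuation K ℤᵐ⁰), Valuation.vle_one_iff (valuation K)]

/-- `Valued.v x < 1 ↔ valuation K x < 1`. [cite: Serre1979, Ch. II §1] -/
theorem v_lt_one_iff_valuation_lt_one (x : K) : Valued.v x < 1 ↔ valuation K x < 1 := by
  rw [← Valuation.vlt_one_iff (Valued.v : Valuation K ℤᵐ⁰), Valuation.vlt_one_iff (valuation K)]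

/-- `Valued.v x = 1 ↔ valuation K x = 1`. [cite: Serre1979, Ch. II §1] -/
theorem v_eq_one_iff_valuation_eq_one (x : K) : Valued.v x = 1 ↔ valuation K x = 1 := by
  rw [← map_one (Valued.v : Valuation K ℤᵐ⁰), v_eq_iff_valuation_eq, map_one]

/-- `Valued.v x ≤ 1 ↔ x ∈ 𝒪[K]` (the valuation ring of the valuative relation). [cite: Serre1979, Ch. II §1] -/
theorem v_le_one_iff_mem_integer (x : K) : Valued.v x ≤ 1 ↔ x ∈ 𝒪[K] := by
  rw [Valuation.mem_integer_iff, v_le_one_iff_valuation_le_one]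

/-- **The two valuation rings coincide**: `Valued.integer K = 𝒪[K]`. [cite: Serre1979, Ch. II §1] -/
theorem valuedInteger_eq_integer : Valued.integer K = 𝒪[K] := by
  ext x
  rw [Valued.integer, Valuation.mem_integer_iff, v_le_one_iff_mem_integer]

/-! ## §2 Discrete valuation ring, uniformizer, residue field -/

/-- **`𝒪[K]` is a discrete valuation ring** when `K` has a uniformizer `v ϖ = exp (-1)` (transport of the tree's `Valued`
statement `CartanUnique.isDiscreteValuationRing_integer`). Stated as a theorem; use with `haveI`. [cite: Serre1979, Ch. I §1, Prop. 1] -/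
theorem isDiscreteValuationRing_integer_of_compatible {ϖ : K} (hϖ : Valued.v ϖ = WithZero.exp (-1 : ℤ)) :
    IsDiscreteValuationRing 𝒪[K] := by
  haveI := CartanUnique.isDiscreteValuationRing_integer hϖ
  exact IsDiscreteValuationRing.RingEquivClass.isDiscreteValuationRing (RingEquiv.subringCongr (valuedInteger_eq_integer (K := K)))

/-- A uniformizer `v ϖ = exp (-1)` is a uniformizing element of `𝒪[K]` in the sense of the `GL_n` files
(`IsUniformizingElement`: it generates the maximal ideal). [cite: Serre1979, Ch. I §1, Prop. 1] -/
theorem isUniformizingElement_of_v_eq {ϖ : K} (hϖ : Valued.v ϖ = WithZero.exp (-1 : ℤ)) : IsUniformizingElement ϖ := by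
  haveI := isDiscreteValuationRing_integer_of_compatible hϖ
  have hmem : ϖ ∈ 𝒪[K] := by
    rw [← v_le_one_iff_mem_integer, hϖ, ← WithZero.exp_zero, WithZero.exp_le_exp]; norm_num
  have hirr : Irreducible (⟨ϖ, hmem⟩ : 𝒪[K]) := by
    have h := (CartanUnique.irreducible_uniformizer hϖ).map (RingEquiv.subringCongr (valuedInteger_eq_integer (K := K)))
    exact h
  exact ⟨hmem, CartanUnique.uniformizer_ne_zero hϖ, (IsDiscreteValuationRing.irreducible_iff_uniformizer _).1 hirr⟩

/-- The residue fields of the two valuation rings are isomorphic, hence `𝓀[K]` is finite when `Valued.ResidueField K` is.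
Stated as a theorem; use with `haveI`. [cite: Serre1979, Ch. I §1] -/
theorem finite_residueField_of_compatible [Finite (Valued.ResidueField K)] : Finite 𝓀[K] :=
  Finite.of_equiv (Valued.ResidueField K)
    (IsLocalRing.ResidueField.mapEquiv (RingEquiv.subringCongr (valuedInteger_eq_integer (K := K)))).toEquiv

/-- **The two residue fields have the same cardinality `q`.** [cite: Serre1979, Ch. I §1] -/
theorem natCard_residueField_eq_of_compatible : Nat.card 𝓀[K] = Nat.card (Valued.ResidueField K) :=
  (Nat.card_congr
    (IsLocalRing.ResidueField.mapEquiv (RingEquiv.subringCongr (valuedInteger_eq_integer (K := K)))).toEquiv).symm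

/-! ## §3 `GL_n(𝒪)` -/

/-- **`g ∈ GL_n(𝒪)` iff all entries of `g` and of `g⁻¹` have `Valued.v ≤ 1`** (the membership test of the `Valued` files,
`unitaryInt` / `symplecticInt`, for the `ValuativeRel` subgroup `glInt n K`). [cite: CartierCorvallis1979, §IV.1] -/
theorem mem_glInt_iff_forall_v_le_one {n : ℕ} (g : GL (Fin n) K) :
    g ∈ glInt n K ↔ (∀ i j, Valued.v ((g : Matrix (Fin n) (Fin n) K) i j) ≤ 1) ∧
      ∀ i j, Valued.v (((g⁻¹ : GL (Fin n) K) : Matrix (Fin n) (Fin n) K) i j) ≤ 1 := by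
  rw [mem_glInt_iff]
  simp only [← v_le_one_iff_mem_integer]

/-! ## §4 Iwasawa exponents of upper triangular elements of `GL_n(K)` -/

section Iwasawa

variable {n : ℕ} {ϖ : K}

omit [ValuativeRel K] [(Valued.v : Valuation K ℤᵐ⁰).Compatible] in
/-- A non-zero `x` with `Valued.v x = exp (-m)` is `ϖ^m · e` with `Valued.v e = 1`. [cite: Serre1979, Ch. I §1] -/
theorem exists_eq_zpow_mul_of_v_eq (hϖ : Valued.v ϖ = WithZero.exp (-1 : ℤ)) {x : K} {m : ℤ}
    (hx : Valued.v x = WithZero.exp (-m)) : ∃ e : K, Valued.v e = 1 ∧ x = ϖ ^ m * e := by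
  have hϖ0 := CartanUnique.uniformizer_ne_zero hϖ
  refine ⟨(ϖ ^ m)⁻¹ * x, ?_, by rw [mul_inv_cancel_left₀ (zpow_ne_zero m hϖ0)]⟩
  rw [map_mul, map_inv₀, CartanUnique.v_uniformizer_zpow hϖ, hx, inv_mul_cancel₀ WithZero.exp_ne_zero]

/-- **The Iwasawa exponents of an upper triangular `b ∈ GL_n(K)` are read off its diagonal**:
`Valued.v (b i i) = exp (-(iwasawaExp hϖ b) i)` (`b = (b D⁻¹) · ϖ^m · (ϖ^{-m} D)` with `D = diag(b_ii)`, `b D⁻¹` unitriangular and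
`ϖ^{-m} D ∈ GL_n(𝒪)`). [cite: CartierCorvallis1979, §IV (4.2)] [cite: BruhatTits1972, (4.4.3)] -/
theorem v_apply_self_eq_exp_neg_iwasawaExp_gl [IsDiscreteValuationRing 𝒪[K]] (hϖ : IsUniformizingElement ϖ)
    (hvϖ : Valued.v ϖ = WithZero.exp (-1 : ℤ)) {b : GL (Fin n) K} (hb : (b : Matrix (Fin n) (Fin n) K).BlockTriangular id)
    (i : Fin n) : Valued.v ((b : Matrix (Fin n) (Fin n) K) i i) = WithZero.exp (-(iwasawaExp hϖ b i)) := by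
  have hϖ0 := CartanUnique.uniformizer_ne_zero hvϖ
  -- exponents and units of the diagonal
  have hne : ∀ j, (b : Matrix (Fin n) (Fin n) K) j j ≠ 0 := apply_self_ne_zero_of_blockTriangular b hb
  have hex : ∀ j, ∃ m : ℤ, Valued.v ((b : Matrix (Fin n) (Fin n) K) j j) = WithZero.exp (-m) := fun j =>
    ⟨-WithZero.log (Valued.v ((b : Matrix (Fin n) (Fin n) K) j j)), by
      rw [neg_neg, WithZero.exp_log ((Valuation.ne_zero_iff _).2 (hne j))]⟩
  choose m hm using hex
  have hex' : ∀ j, ∃ e : K, Valued.v e = 1 ∧ (b : Matrix (Fin n) (Fin n) K) j j = ϖ ^ m j * e := fun j =>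
    exists_eq_zpow_mul_of_v_eq hvϖ (hm j)
  choose e he1 hbe using hex'
  have he0 : ∀ j, e j ≠ 0 := fun j h0 => by
    have h1 := he1 j
    rw [h0, map_zero] at h1
    exact zero_ne_one h1
  -- the unit diagonal `E = diag(e)` lies in `GL_n(𝒪)`
  set E : GL (Fin n) K := diagonalGL (Fin n) K fun j => Units.mk0 (e j) (he0 j) with hE
  have hEint : E ∈ glInt n K := by
    refine diagonalGL_mem_glInt fun j => ?_
    rw [Units.val_mk0, ← v_eq_one_iff_valuation_eq_one]; exact he1 j
  -- `b = (b D⁻¹) · ϖ^m · E`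
  have hD : diagonalGL (Fin n) K (diagPart b hb) = zpowDiagGL hϖ0 m * E := by
    refine Units.ext ?_
    rw [Units.val_mul, coe_diagonalGL, coe_zpowDiagGL, hE, coe_diagonalGL, Matrix.diagonal_mul_diagonal]
    congr 1
    funext j
    rw [coe_diagPart, Units.val_mk0, hbe j]
  have hfac : b = b * (diagonalGL (Fin n) K (diagPart b hb))⁻¹ * zpowDiagGL hϖ.ne_zero m * E := by
    have h0 : zpowDiagGL hϖ.ne_zero m = zpowDiagGL hϖ0 m := rfl
    rw [h0, mul_assoc (b * _), ← hD, inv_mul_cancel_right]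
  rw [iwasawaExp_eq hϖ (mul_diagonalGL_inv_mem_upperUnitriangular b hb) hEint hfac, hm i]

omit [ValuativeRel K] [(Valued.v : Valuation K ℤᵐ⁰).Compatible] in
/-- Injectivity of `m ↦ exp (-m)` read entrywise: two exponent vectors with the same `exp (-·)` agree. [folklore] -/
private theorem eq_of_forall_exp_neg_eq {m m' : Fin n → ℤ} (h : ∀ i, WithZero.exp (-m i) = WithZero.exp (-m' i)) : m = m' := by
  funext i
  have := WithZero.exp_injective (h i)
  omega

/-- **Uniqueness form**: if an upper triangular `b ∈ GL_n(K)` has `Valued.v (b i i) = exp (-a i)` for all `i`, then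
`iwasawaExp hϖ b = a`. [cite: BruhatTits1972, (4.4.3)] -/
theorem iwasawaExp_eq_of_forall_v_apply_self_eq [IsDiscreteValuationRing 𝒪[K]] (hϖ : IsUniformizingElement ϖ)
    (hvϖ : Valued.v ϖ = WithZero.exp (-1 : ℤ)) {b : GL (Fin n) K} (hb : (b : Matrix (Fin n) (Fin n) K).BlockTriangular id)
    {a : Fin n → ℤ} (ha : ∀ i, Valued.v ((b : Matrix (Fin n) (Fin n) K) i i) = WithZero.exp (-a i)) : iwasawaExp hϖ b = a :=
  eq_of_forall_exp_neg_eq fun i => by rw [← v_apply_self_eq_exp_neg_iwasawaExp_gl hϖ hvϖ hb i, ha i]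

end Iwasawa

end Literature.NumberTheory.Automorphic

end
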